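import Summits.Ventures.HodgeRepro2.T5BergmanGodement

/-!
# Godement's identity in operator form: `π_k(φ)` acts through point evaluations

`T5BergmanGodement` proves the convolution identity for matrix coefficients against Rühl's measure,
`∫_G ⟨π_k(g x⁻¹) f, h⟩_k ⟨π_k(x) f', h'⟩_k dμ_R(x) = ⟨f, h'⟩_k ⟨π_k(g) f', h⟩_k / (k - 1)`.
Taking `h = K_z` a coherent state and using the reproducing formula
`⟨F, K_z⟩_k = π/(k-1) · F(z)` (`T5BergmanKernel.pairing_kernel`, here for holomorphic `F`:
`pairing_kernel_of_differentiableOn`), the matrix coefficient against `K_z` is the point evaluation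
`⟨π_k(g) f, K_z⟩_k = π/(k-1) · (π_k(g) f)(z)` (`matrixCoeff_kernel`), and Godement's identity
becomes the OPERATOR identity, pointwise on the disc:
`∫_G (π_k(g x⁻¹) f)(z) ⟨π_k(x) f', h'⟩_k dμ_R(x) = ⟨f, h'⟩_k (π_k(g) f')(z) / (k - 1)`
(`godement_operator`) — i.e. `π_k(g) ∘ π_k(φ_{f',h'}) = (k-1)⁻¹ · (f ↦ ⟨f, h'⟩_k π_k(g) f')`
for the coefficient `φ_{f',h'}(x) = ⟨π_k(x) f', h'⟩_k`; at `g = 1` the convolution operator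
`π_k(φ_{v,v})` is `(k-1)⁻¹` times the rank-one operator `f ↦ ⟨f, v⟩_k v` (`godement_operator_one`,
`godement_operator_rankOne`). Nothing is claimed about (N).

Blind lane: Mathlib + the HodgeRepro2 prefix only; no sorry; axioms ⊆ {propext, Classical.choice,
Quot.sound}.
-/

namespace Summit.Ventures.HodgeRepro2.T5BergmanGodementOperator

open MeasureTheory MeasureTheory.Measure Metric Filter Topology Set
open T5PoincareDensity T5PoincareMeasure T5SU11Unimodular T5SU11Fibration T5SU11FibrationHaar
  T5SU11FibrationCartan T5HaarCircle T5SU11CoefficientL2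
open T5BergmanCoefficient T5BergmanPairing T5BergmanUnitary T5BergmanCoefficientL2 T5BergmanFourier
  T5BergmanParseval T5BergmanProjection T5BergmanActStable T5BergmanMatrixCoeff T5BergmanSchur
  T5BergmanSchurGeneral T5BergmanSchurPolarized T5BergmanKernel T5BergmanCoeffL2 T5BergmanGodement
open scoped Real

/-! ### The reproducing formula for holomorphic vectors; coefficients against coherent states -/

/-- **The reproducing formula for holomorphic `f ∈ A_k`**: `⟨f, K_z⟩_k = π/(k-1) · f(z)` for
`z ∈ 𝔻` (the `HasSum` hypothesis of `T5BergmanKernel.pairing_kernel` is supplied by the Taylor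
series, `T5BergmanParseval.hasSum_taylor`). -/
theorem pairing_kernel_of_differentiableOn (k : ℕ) (hk : 2 ≤ k) (f : ℂ → ℂ)
    (hf : DifferentiableOn ℂ f (ball 0 1))
    (hint : IntegrableOn (fun w => ‖f w‖ ^ 2 * (1 - ‖w‖ ^ 2) ^ (k - 2)) (ball (0 : ℂ) 1))
    {z : ℂ} (hz : z ∈ ball (0 : ℂ) 1) :
    pairing k f (kernel k z) = ((π / ((k : ℝ) - 1) : ℝ) : ℂ) * f z :=
  pairing_kernel k hk (taylorCoeff f) f (hasSum_taylor f hf) hint hz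

/-- **A matrix coefficient against a coherent state is a point evaluation**:
`⟨π_k(g) f, K_z⟩_k = π/(k-1) · (π_k(g) f)(z)`. -/
theorem matrixCoeff_kernel (k : ℕ) (hk : 2 ≤ k) (f : ℂ → ℂ)
    (hf : DifferentiableOn ℂ f (ball 0 1))
    (hfint : IntegrableOn (fun w => ‖f w‖ ^ 2 * (1 - ‖w‖ ^ 2) ^ (k - 2)) (ball (0 : ℂ) 1))
    (g : SU11) {z : ℂ} (hz : z ∈ ball (0 : ℂ) 1) :
    matrixCoeff k f (kernel k z) g = ((π / ((k : ℝ) - 1) : ℝ) : ℂ) * act k g f z :=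
  pairing_kernel_of_differentiableOn k hk _ (differentiableOn_act k g f hf)
    (integrableOn_act k hk g f hf hfint) hz

/-- The constant `π/(k-1)` is non-zero for `k ≥ 2`. -/
lemma pi_div_ne_zero (k : ℕ) (hk : 2 ≤ k) : ((π / ((k : ℝ) - 1) : ℝ) : ℂ) ≠ 0 := by
  have h2 : (2 : ℝ) ≤ k := by exact_mod_cast hk
  have : (0 : ℝ) < π / ((k : ℝ) - 1) := div_pos Real.pi_pos (by linarith)
  exact_mod_cast this.ne'

/-! ### Godement's identity in operator form -/

variable [MeasurableSpace Circle] [BorelSpace Circle]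

/-- **GODEMENT'S IDENTITY IN OPERATOR FORM**: for holomorphic `f, f', h' ∈ A_k` (`k ≥ 2`),
`g ∈ SU(1,1)` and `z ∈ 𝔻`,
`∫_G (π_k(g x⁻¹) f)(z) ⟨π_k(x) f', h'⟩_k dμ_R(x) = ⟨f, h'⟩_k (π_k(g) f')(z) / (k - 1)`. -/
theorem godement_operator (k : ℕ) (hk : 2 ≤ k) (f f' h' : ℂ → ℂ)
    (hf : DifferentiableOn ℂ f (ball 0 1))
    (hfint : IntegrableOn (fun w => ‖f w‖ ^ 2 * (1 - ‖w‖ ^ 2) ^ (k - 2)) (ball (0 : ℂ) 1))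
    (hf' : DifferentiableOn ℂ f' (ball 0 1))
    (hf'int : IntegrableOn (fun w => ‖f' w‖ ^ 2 * (1 - ‖w‖ ^ 2) ^ (k - 2)) (ball (0 : ℂ) 1))
    (hh' : DifferentiableOn ℂ h' (ball 0 1))
    (hh'int : IntegrableOn (fun w => ‖h' w‖ ^ 2 * (1 - ‖w‖ ^ 2) ^ (k - 2)) (ball (0 : ℂ) 1))
    (g : SU11) {z : ℂ} (hz : z ∈ ball (0 : ℂ) 1) :
    ∫ x, act k (g * x⁻¹) f z * matrixCoeff k f' h' x ∂ruhl =
      pairing k f h' * act k g f' z / ((k : ℂ) - 1) := by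
  set c : ℂ := ((π / ((k : ℝ) - 1) : ℝ) : ℂ) with hc
  have hc0 : c ≠ 0 := pi_div_ne_zero k hk
  have h := integral_matrixCoeff_mul_inv_mul k hk f (kernel k z) f' h' hf hfint
    (differentiableOn_kernel k hz)
    (integrableOn_sq_weight_of_continuousOn k (continuousOn_kernel k hz)) hf' hf'int hh' hh'int g
  have e1 : ∀ x : SU11, matrixCoeff k f (kernel k z) (g * x⁻¹) * matrixCoeff k f' h' x =
      c * (act k (g * x⁻¹) f z * matrixCoeff k f' h' x) := fun x => by
    rw [matrixCoeff_kernel k hk f hf hfint (g * x⁻¹) hz, ← hc]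
    ring
  simp_rw [e1] at h
  rw [integral_const_mul, matrixCoeff_kernel k hk f' hf' hf'int g hz, ← hc] at h
  apply mul_left_cancel₀ hc0
  rw [h]
  ring

/-- **The convolution operator `π_k(φ_{f',h'})` at `g = 1`**:
`∫_G (π_k(x⁻¹) f)(z) ⟨π_k(x) f', h'⟩_k dμ_R(x) = ⟨f, h'⟩_k f'(z) / (k - 1)`. -/
theorem godement_operator_one (k : ℕ) (hk : 2 ≤ k) (f f' h' : ℂ → ℂ)
    (hf : DifferentiableOn ℂ f (ball 0 1))
    (hfint : IntegrableOn (fun w => ‖f w‖ ^ 2 * (1 - ‖w‖ ^ 2) ^ (k - 2)) (ball (0 : ℂ) 1))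
    (hf' : DifferentiableOn ℂ f' (ball 0 1))
    (hf'int : IntegrableOn (fun w => ‖f' w‖ ^ 2 * (1 - ‖w‖ ^ 2) ^ (k - 2)) (ball (0 : ℂ) 1))
    (hh' : DifferentiableOn ℂ h' (ball 0 1))
    (hh'int : IntegrableOn (fun w => ‖h' w‖ ^ 2 * (1 - ‖w‖ ^ 2) ^ (k - 2)) (ball (0 : ℂ) 1))
    {z : ℂ} (hz : z ∈ ball (0 : ℂ) 1) :
    ∫ x, act k x⁻¹ f z * matrixCoeff k f' h' x ∂ruhl = pairing k f h' * f' z / ((k : ℂ) - 1) := by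
  have h := godement_operator k hk f f' h' hf hfint hf' hf'int hh' hh'int 1 hz
  simp only [one_mul, act_one] at h
  exact h

/-- **`π_k(φ_v)` is `(k-1)⁻¹` times the rank-one projector onto `v`**: for the coefficient
`φ_v(x) = ⟨π_k(x) v, v⟩_k` of a holomorphic `v ∈ A_k`,
`∫_G (π_k(x⁻¹) f)(z) φ_v(x) dμ_R(x) = ⟨f, v⟩_k v(z) / (k - 1)` for every holomorphic `f ∈ A_k`. -/
theorem godement_operator_rankOne (k : ℕ) (hk : 2 ≤ k) (f v : ℂ → ℂ)
    (hf : DifferentiableOn ℂ f (ball 0 1))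
    (hfint : IntegrableOn (fun w => ‖f w‖ ^ 2 * (1 - ‖w‖ ^ 2) ^ (k - 2)) (ball (0 : ℂ) 1))
    (hv : DifferentiableOn ℂ v (ball 0 1))
    (hvint : IntegrableOn (fun w => ‖v w‖ ^ 2 * (1 - ‖w‖ ^ 2) ^ (k - 2)) (ball (0 : ℂ) 1))
    {z : ℂ} (hz : z ∈ ball (0 : ℂ) 1) :
    ∫ x, act k x⁻¹ f z * matrixCoeff k v v x ∂ruhl = pairing k f v * v z / ((k : ℂ) - 1) :=
  godement_operator_one k hk f v v hf hfint hv hvint hv hvint hz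

end Summit.Ventures.HodgeRepro2.T5BergmanGodementOperator
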